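import Literature.MathematicalPhysics.QuantumFieldTheory.Balaban1983to89.B9SectCDiffCutModelToy4

/-!
# `Balaban1983to89.B9SectCLatticeCalc` — the abstract LATTICE CALCULUS behind the Leibniz block of the cut model:
# positioned operators, the exchange rule, and the `𝔇(∂) / 𝔇(∂*) / hA / hM`-shape identities as THEOREMS in any
# dimension (D2 of the census, first leaf) — OURS

CITATION HEADER (LEAF RULE: no quotation in this file; pointers BY NAME only).  The published setting is the one
quoted verbatim in the headers of `…B9SectCDiff` (the commutator formula for covariant derivatives and the sentence
on `[D*D, h]`, `[DD*, h]`, Balaban, *Commun. Math. Phys.* **99** (1985) 389–434, §C, (3.100), p. 413) and of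
`…B9SectCDiffCutModel` (the cut-model packaging); this file adds nothing from print.  Tree inputs, by name:
`B9SectCDiff.{tdef, tdef_def, tdef_mul}` (the twisted defect `𝔇(T) = XU·T₂ − T₁·XV` and its Leibniz rule);
for the sanity instance of §6 only: `B9SectCDiffCutModelToy4.{ι, ι_lt, ι_injective, site, ι_site, exists_succ,
exists_pred, Sh, Sh_apply, fd, fd_eq, fd_eq_zero, bfd, bfd_eq, bfd_eq_zero, Th}`; Mathlib's `Matrix.diagonal`,
`Matrix.diagonal_mul`, `Matrix.mul_diagonal`, `Matrix.diagonal_sub`, `Matrix.diagonal_neg`, `Matrix.diagonal_apply_ne`,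
`Matrix.sum_mul`, `Matrix.mul_sum`, `Matrix.sum_apply`, `Finset.sum_ite_eq`, `Fintype.sum_prod_type`.  `IsCarried` is a
support PREDICATE on an entry table (a data hypothesis, like `OpZon` / `Realizes` of `…B9SectCDiffExpansion`), not
a named fact.  (The brief asked for an import of `…B9SectCDiffCutModel` only; it is
widened to `…B9SectCDiffCutModelToy4` — which imports the former — solely so that §6 can name the toy line's
`Sh / ι / fd / bfd / Th`; §§1–5 use nothing beyond `B9SectCDiff.tdef` and Mathlib, and a later split of §6 into its
own file is mechanical.)

WHAT THIS MODULE DOES (census `SectC-inst-census.md` §5 item D2 and the new §7; claim SECTC-LATTICE-CALC).  The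
`CutModel` of `…B9SectCDiffCutModel` asks, as HYPOTHESES `hΛ / hM / hA`, for one-sided Leibniz identities
`𝔇(Λ) = Lm₁·Dv + Lm₀`, `∂·𝔇(∂*) = Dm₁·Dv + Dm₀`, `𝔇(Δ′) = Am₁·∂ + Am₀` of the cutoff commutators of the lattice
operators; the toy files `…Toy4`–`…Toy17` discharge them on ONE object (the `d = 1` line, one level).  This file
isolates the purely combinatorial mechanism that makes such identities hold for lattice difference operators IN
ANY DIMENSION, with ARBITRARY real entries (gauge transporters `R(U(b))` in components, `η`-weights, boundary
deletions), and proves the identities once, abstractly: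
* §1 **POSITIONED OPERATORS.**  A set of positions `E`; carriers (index types) whose elements have positions; a
  matrix `K : Matrix u v ℝ` is CARRIED by a pair of position maps `(ρ, κ)` (`IsCarried ρ κ K`) when on its
  support the row position `ρ i` equals the column position `κ j`.  THE EXCHANGE RULE (`IsCarried.exchange`):
  `diagonal (f ∘ ρ)·K = K·diagonal (f ∘ κ)` — a multiplication operator passes through a carried operator,
  changing its position map.  A matrix carried by `(ρ, ρ)` has ZERO twisted defect (`IsCarried.tdef_eq_zero`).
* §2 **FIRST-ORDER TWO-PART OPERATORS.**  Sites `s` (positions `xs`), bonds `b` with a source position `sb` and a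
  target position `tb`; a "gradient" `∂ = T − J : Matrix b s ℝ` whose target part `T` is carried by `(tb, xs)`
  and whose source part `J` is carried by `(sb, xs)` (for Balaban's `η⁻¹(R(U(b))A(b₊) − A(b₋))`: `T(b, b₊) =
  η⁻¹R(U(b))`-component, `J(b, b₋) = η⁻¹`); a "divergence" `∂* = T′ − J′ : Matrix s b ℝ` carried the other way.
  With the cutoffs `χ_s = diagonal (h ∘ xs)`, `χ_b = diagonal (h ∘ sb)` and `Θ_h = diagonal (h ∘ tb − h ∘ sb)`
  (`ThE`, first differences of `h` ALONG THE BONDS): **`𝔇(∂) = −Θ_h·T`** (`tdef_fwd`) and **`𝔇(∂*) = T′·Θ_h`**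
  (`tdef_bwd`) — exact, every `h`, every dimension, every entry table with these supports.
* §3 **THE `hA` SHAPE: `𝔇(∂*∂) = (J′Θ_h + T′Θ_h)·∂ + (J′Θ_hJ − T′Θ_hT)`** (`tdef_bwd_fwd`; the `T′Θ_hT` terms of
  the Leibniz expansion CANCEL identically; `hA_shape` adds any position-diagonal term `W`, `𝔇(W) = 0`).  The coefficient `Am₁ = J′Θ_h + T′Θ_h` is first differences of `h`
  times `h`-free entries; the remainder `Am₀ = J′Θ_hJ − T′Θ_hT` is a position-diagonal-type operator whose
  smallness to SECOND order is NOT algebra (it needs the unitarity `J′J`-block = `T′T`-block per direction and `h`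
  constant near defective positions — exactly as on the toy line, where it is Toy4's `Ξ_h = Θ_h − SᵀΘ_hS`); this
  file proves the identity and says so.
* §4 **THE `hM` SHAPE NEEDS DIRECTIONS.**  With a direction map `dir : b → Δ`, the direction parts `T′_μ`
  (`dpart`; `Σ_μ T′_μ = T′`, `sum_dpart`) and direction-wise pulled-back differences `θ_μ : E → ℝ` tied to `h` by
  the hypothesis `hθ : T′(v, c) ≠ 0 → θ_(dir c)(xs v) = h(tb c) − h(sb c)` (on a lattice: `θ_μ(x) = h(x) −
  h(x − e_μ)`): `T′_μ·Θ_h = diagonal(θ_μ ∘ xs)·T′_μ` (`dpart_mul_ThE`) and **`∂·𝔇(∂*) = Σ_μ diagonal(θ_μ ∘ sb)·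
  (∂·T′_μ) + Σ_μ Θ_(θ_μ)·(T·T′_μ)`** (`fwd_mul_bwd_ThE`): coefficient = first differences, derivative part `∂·T′_μ`
  (mixed second covariant differences, `h`-free), remainder = SECOND differences `Θ_(θ_μ)` times `h`-free
  `T·T′_μ`.  Packaged on the carrier `t := Δ × b` as **`∂·𝔇(∂*) = Dm₁·Dv + Dm₀`** (`Dv`, `Dm₁`, `Dm₀`,
  `hM_shape`) — literally the shape of the `CutModel` field `hM`, with `Dv(μ, a) = (∂·T′_μ)(a, ·)`.
* §5 **SEVERAL PARTS** (`tdef_parts`, `tdef_parts_mul`): for `K = Σ_k K_k` with `K_k` carried by `(τ_k, κ)`,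
  `𝔇(K) = −Σ_k diagonal(h ∘ τ_k − h ∘ ρ)·K_k` and `𝔇(K′K) = Σ_k Σ_l K′_k·diagonal(h ∘ τ_k − h ∘ τ_l)·K_l` (the
  diagonal `k = l` terms vanish).  LOCATED OBSTRUCTION for `hΛ`: the local part of the VECTOR operator (the
  plaquette `D*D` of the printed (3.10) plus a bounded perturbation) has FOUR bonds per plaquette row, and the
  `k ≠ l` cross terms between its two target-type parts are bond-to-bond hops between DIFFERENT directions with
  FIRST-difference coefficients; a one-sided form `Lm₁·Dv + Lm₀` with `Lm₀` of second order therefore does not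
  come from one row — it needs a cancellation between neighbouring plaquettes (its continuum shadow: `[curl*curl,
  h]A` contains no `η⁻¹(∂h)·A` term).  `hΛ` for the real `Λ` is NOT proved here; census §7 records it as the next
  item of D2.
* §6 **SANITY INSTANCE: the toy line of `…Toy4`** (`E = s = b = Fin n × Fin B`, `xs = sb = id`, `tb = nxt` = the
  successor-or-self, `T = diagonal w·S`, `J = diagonal u`, `T′ = Sᵀ·diagonal w′`, `J′ = diagonal u′`, one
  direction): `Θ_h` IS Toy4's `Th h` (`ThE_toy`), the pulled-back differences are Toy4's `bfd h`
  (`bfd_eq_sub_prv`), and §§2–4 specialise to WEIGHTED versions of Toy4's `dD_eq / dDt_eq / dDtD_eq`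
  (`toy_tdef_fwd`, `toy_tdef_bwd`, `toy_tdef_bwd_fwd`; the weights `w = u = w′ = u′ = 1` give Toy4's statements,
  which are not restated) and to an `hM` split with `Dv = ∂·Sᵀ_w′` (`toy_hM_shape`) — a valid split DIFFERENT
  from Toy4's `D_mul_dDt` (which chose `Dv = ∂`); both are exact.

HONEST CAVEATS.  (1) IDENTITIES ONLY: no norms, no `OpZon`/`Realizes` classes, no order bookkeeping — that the
coefficients are of first and the remainders of second order in `M⁻¹` is the business of the estimate files and,
for `Am₀`, needs more than supports (§3).  (2) The scalar level (`∂ : scalars → 1-forms` and `∂*`) is covered in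
full generality; the 2-form level needed for the vector operator's `hΛ` is only LOCATED (§5), not done.  (3) The
derivative `Dv = (∂·T′_μ)_μ` of §4 transports along two bonds; it differs from the printed one-transporter
covariant derivative (3.3)/(3.4) by a plaquette-holonomy conjugation — harmless algebraically, an item for the
estimate side (which gradient bound of the printed Theorem 3.3 controls `Dv·G`).  (4) Value = located bookkeeping
for the `CutModel` fields `hM`, `hA` in general dimension — NOT summit progress.  Every declaration carries a
docstring + `[folklore]` tag; no `sorry`; no `instance`; no `HarnessLib` fact; standard axioms only.
-/

namespace Literature.MathematicalPhysics.QuantumFieldTheory.Balaban1983to89.B9SectCLatticeCalc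

open Finset
open B9SectCDiff (tdef tdef_def tdef_mul)
open B9SectCDiffCutModelToy4 (ι ι_lt ι_injective site ι_site exists_succ exists_pred Sh Sh_apply fd fd_eq
  fd_eq_zero bfd bfd_eq bfd_eq_zero Th)

noncomputable section

/-! ## §1 Positioned operators and the exchange rule -/

section Carried

variable {E u v : Type*}

/-- `K : Matrix u v ℝ` is CARRIED by the position maps `ρ` (rows) and `κ` (columns): on the support of `K` the row
position equals the column position.  (For a lattice difference operator split into its parts, each part is carried
by the appropriate endpoint map.)  OURS (typing). [folklore] -/
def IsCarried (ρ : u → E) (κ : v → E) (K : Matrix u v ℝ) : Prop := ∀ i j, K i j ≠ 0 → ρ i = κ j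

variable {ρ : u → E} {κ : v → E} {K L : Matrix u v ℝ}

/-- support domination preserves being carried. [folklore] -/
theorem IsCarried.of_support (hK : IsCarried ρ κ K) (hL : ∀ i j, L i j ≠ 0 → K i j ≠ 0) : IsCarried ρ κ L :=
  fun i j h => hK i j (hL i j h)

/-- [folklore] -/
theorem IsCarried.transpose (hK : IsCarried ρ κ K) : IsCarried κ ρ K.transpose :=
  fun j i h => (hK i j h).symm

/-- [folklore] -/
theorem IsCarried.neg (hK : IsCarried ρ κ K) : IsCarried ρ κ (-K) :=
  hK.of_support fun i j h => by rwa [Matrix.neg_apply, neg_ne_zero] at h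

/-- a diagonal matrix is carried by `(ρ, ρ)` for every position map. [folklore] -/
theorem isCarried_diagonal [DecidableEq u] (ρ : u → E) (d : u → ℝ) : IsCarried ρ ρ (Matrix.diagonal d) := by
  intro i j h
  by_contra hne
  exact h (Matrix.diagonal_apply_ne d fun hij => hne (congrArg ρ hij))

/-- left multiplication by a diagonal matrix preserves being carried. [folklore] -/
theorem IsCarried.diagonal_mul [Fintype u] [DecidableEq u] (hK : IsCarried ρ κ K) (d : u → ℝ) :
    IsCarried ρ κ (Matrix.diagonal d * K) :=
  hK.of_support fun i j h => by rw [Matrix.diagonal_mul] at h; exact right_ne_zero_of_mul h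

/-- right multiplication by a diagonal matrix preserves being carried. [folklore] -/
theorem IsCarried.mul_diagonal [Fintype v] [DecidableEq v] (hK : IsCarried ρ κ K) (d : v → ℝ) :
    IsCarried ρ κ (K * Matrix.diagonal d) :=
  hK.of_support fun i j h => by rw [Matrix.mul_diagonal] at h; exact left_ne_zero_of_mul h

variable [Fintype u] [Fintype v] [DecidableEq u] [DecidableEq v]

/-- **THE EXCHANGE RULE**: a multiplication operator passes through a carried operator, its position map changing
from the row map to the column map: `diagonal (f ∘ ρ)·K = K·diagonal (f ∘ κ)`. [folklore] -/
theorem IsCarried.exchange (hK : IsCarried ρ κ K) (f : E → ℝ) :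
    Matrix.diagonal (f ∘ ρ) * K = K * Matrix.diagonal (f ∘ κ) := by
  ext i j
  rw [Matrix.diagonal_mul, Matrix.mul_diagonal, Function.comp_apply, Function.comp_apply]
  by_cases h0 : K i j = 0
  · rw [h0, mul_zero, zero_mul]
  · rw [hK i j h0, mul_comm]

omit [Fintype v] [DecidableEq v] in
/-- a matrix carried by `(ρ, ρ)` (position-diagonal: e.g. a multiplication operator, a local rotation of
components) has ZERO twisted defect for the cutoff `h ∘ ρ`. [folklore] -/
theorem IsCarried.tdef_eq_zero {K : Matrix u u ℝ} (hK : IsCarried ρ ρ K) (h : E → ℝ) :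
    tdef (Matrix.diagonal (h ∘ ρ)) (Matrix.diagonal (h ∘ ρ)) K K = 0 := by
  rw [tdef_def, hK.exchange, sub_self]

end Carried

/-! ## §2 First-order two-part operators: `𝔇(∂) = −Θ_h·T`, `𝔇(∂*) = T′·Θ_h` -/

section TwoPart

variable {E s b Δ : Type*}

/-- the first differences of `f : E → ℝ` ALONG THE BONDS, as a diagonal bond operator:
`Θ_f = diagonal (f ∘ tb − f ∘ sb)`. OURS (typing). [folklore] -/
def ThE [DecidableEq b] (sb tb : b → E) (f : E → ℝ) : Matrix b b ℝ := Matrix.diagonal fun a => f (tb a) - f (sb a)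

/-- [folklore] -/
theorem ThE_apply [DecidableEq b] (sb tb : b → E) (f : E → ℝ) (a c : b) :
    ThE sb tb f a c = if a = c then f (tb a) - f (sb a) else 0 := by
  unfold ThE; rw [Matrix.diagonal_apply]

/-- `Θ_f = diagonal (f ∘ tb) − diagonal (f ∘ sb)`. [folklore] -/
theorem ThE_eq [DecidableEq b] (sb tb : b → E) (f : E → ℝ) :
    ThE sb tb f = Matrix.diagonal (f ∘ tb) - Matrix.diagonal (f ∘ sb) := by
  unfold ThE; rw [Matrix.diagonal_sub]; rfl

/-- the part of `T′ : Matrix s b ℝ` through the bonds of direction `μ` (`dir : b → Δ` the direction map).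
OURS (typing). [folklore] -/
def dpart [DecidableEq Δ] (dir : b → Δ) (μ : Δ) (T' : Matrix s b ℝ) : Matrix s b ℝ :=
  Matrix.of fun v c => if dir c = μ then T' v c else 0

/-- [folklore] -/
theorem dpart_apply [DecidableEq Δ] (dir : b → Δ) (μ : Δ) (T' : Matrix s b ℝ) (v : s) (c : b) :
    dpart dir μ T' v c = if dir c = μ then T' v c else 0 := rfl

/-- `Σ_μ T′_μ = T′`. [folklore] -/
theorem sum_dpart [Fintype Δ] [DecidableEq Δ] (dir : b → Δ) (T' : Matrix s b ℝ) : ∑ μ, dpart dir μ T' = T' := by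
  ext v c
  rw [Matrix.sum_apply]
  simp only [dpart_apply]
  rw [Finset.sum_ite_eq, if_pos (Finset.mem_univ _)]

variable {xs : s → E} {sb tb : b → E} {T J : Matrix b s ℝ} {T' J' : Matrix s b ℝ}

/-- a direction part of a carried operator is carried. [folklore] -/
theorem IsCarried.dpart [DecidableEq Δ] (hT' : IsCarried xs tb T') (dir : b → Δ) (μ : Δ) :
    IsCarried xs tb (dpart dir μ T') :=
  hT'.of_support fun v c h => by
    rw [dpart_apply] at h
    by_cases hc : dir c = μ
    · rwa [if_pos hc] at h
    · exact absurd (if_neg hc) fun h' => h h'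

variable [Fintype s] [Fintype b] [DecidableEq s] [DecidableEq b]

/-- **`𝔇(∂) = χ_b·∂ − ∂·χ_s = −Θ_h·T`** for `∂ = T − J` with `T` carried by `(tb, xs)` and `J` by `(sb, xs)`,
`χ_s = diagonal (h ∘ xs)`, `χ_b = diagonal (h ∘ sb)` — exact, every `h`. [folklore] -/
theorem tdef_fwd (hT : IsCarried tb xs T) (hJ : IsCarried sb xs J) (h : E → ℝ) :
    tdef (Matrix.diagonal (h ∘ sb)) (Matrix.diagonal (h ∘ xs)) (T - J) (T - J) = -(ThE sb tb h * T) := by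
  rw [tdef_def, Matrix.mul_sub, Matrix.sub_mul, ← hT.exchange, ← hJ.exchange, ThE_eq, Matrix.sub_mul]
  abel

/-- **`𝔇(∂*) = χ_s·∂* − ∂*·χ_b = T′·Θ_h`** for `∂* = T′ − J′` with `T′` carried by `(xs, tb)` and `J′` by
`(xs, sb)` — exact, every `h`. [folklore] -/
theorem tdef_bwd (hT' : IsCarried xs tb T') (hJ' : IsCarried xs sb J') (h : E → ℝ) :
    tdef (Matrix.diagonal (h ∘ xs)) (Matrix.diagonal (h ∘ sb)) (T' - J') (T' - J') = T' * ThE sb tb h := by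
  rw [tdef_def, Matrix.mul_sub, Matrix.sub_mul, hT'.exchange, hJ'.exchange, ThE_eq, Matrix.mul_sub]
  abel

/-! ## §3 The `hA` shape: `𝔇(∂*∂) = (J′Θ + T′Θ)·∂ + (J′ΘJ − T′ΘT)` -/

/-- **THE `hA` SHAPE: `𝔇(∂*∂) = (J′Θ_h + T′Θ_h)·∂ + (J′Θ_hJ − T′Θ_hT)`** (Leibniz with the bond cutoff in the
middle; the `T′Θ_hT` terms cancel identically).  Coefficient `Am₁ = J′Θ_h + T′Θ_h`, remainder
`Am₀ = J′Θ_hJ − T′Θ_hT` (whose second-order smallness is NOT a consequence of the supports; header §3). [folklore] -/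
theorem tdef_bwd_fwd (hT : IsCarried tb xs T) (hJ : IsCarried sb xs J) (hT' : IsCarried xs tb T')
    (hJ' : IsCarried xs sb J') (h : E → ℝ) :
    tdef (Matrix.diagonal (h ∘ xs)) (Matrix.diagonal (h ∘ xs)) ((T' - J') * (T - J)) ((T' - J') * (T - J)) =
      (J' * ThE sb tb h + T' * ThE sb tb h) * (T - J) + (J' * ThE sb tb h * J - T' * ThE sb tb h * T) := by
  rw [tdef_mul (Matrix.diagonal (h ∘ xs)) (Matrix.diagonal (h ∘ sb)) (Matrix.diagonal (h ∘ xs)),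
    tdef_bwd hT' hJ', tdef_fwd hT hJ]
  simp only [Matrix.mul_sub, Matrix.sub_mul, Matrix.add_mul, Matrix.mul_neg, Matrix.mul_assoc]
  abel

/-- the same identity with the `Am₁ / Am₀` names spelled out as an existential-free package: for every additional
position-diagonal-type term `W` carried by `(xs, xs)` (a mass term, a multiplication operator),
`𝔇(∂*∂ + W) = Am₁·∂ + Am₀` with `Am₁ = J′Θ_h + T′Θ_h`, `Am₀ = J′Θ_hJ − T′Θ_hT`. [folklore] -/
theorem hA_shape (hT : IsCarried tb xs T) (hJ : IsCarried sb xs J) (hT' : IsCarried xs tb T')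
    (hJ' : IsCarried xs sb J') {W : Matrix s s ℝ} (hW : IsCarried xs xs W) (h : E → ℝ) :
    tdef (Matrix.diagonal (h ∘ xs)) (Matrix.diagonal (h ∘ xs)) ((T' - J') * (T - J) + W) ((T' - J') * (T - J) + W) =
      (J' * ThE sb tb h + T' * ThE sb tb h) * (T - J) + (J' * ThE sb tb h * J - T' * ThE sb tb h * T) := by
  rw [B9SectCDiff.tdef_add, tdef_bwd_fwd hT hJ hT' hJ', hW.tdef_eq_zero, add_zero]

/-! ## §4 The `hM` shape needs directions: `∂·𝔇(∂*) = Dm₁·Dv + Dm₀` -/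

variable [DecidableEq Δ] (dir : b → Δ) {θs : Δ → E → ℝ} {h : E → ℝ}

/-- **`T′_μ·Θ_h = diagonal (θ_μ ∘ xs)·T′_μ`**: through the direction-`μ` part, the bond differences of `h` become
the multiplication operator by the direction-`μ` pulled-back difference `θ_μ` (hypothesis `hθ`: at the target of a
bond `c` carrying an entry of `T′`, `θ_(dir c)` is the difference of `h` along `c`). [folklore] -/
theorem dpart_mul_ThE (hθ : ∀ v c, T' v c ≠ 0 → θs (dir c) (xs v) = h (tb c) - h (sb c)) (μ : Δ) :
    dpart dir μ T' * ThE sb tb h = Matrix.diagonal (θs μ ∘ xs) * dpart dir μ T' := by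
  ext v c
  rw [ThE, Matrix.mul_diagonal, Matrix.diagonal_mul, dpart_apply, Function.comp_apply]
  by_cases hc : dir c = μ
  · rw [if_pos hc]
    by_cases h0 : T' v c = 0
    · rw [h0, zero_mul, mul_zero]
    · rw [← hc, hθ v c h0, mul_comm]
  · rw [if_neg hc, zero_mul, mul_zero]

/-- the stacked derivative `Dv : Matrix (Δ × b) b ℝ`, `Dv((μ, a), ·) = (∂·T′_μ)(a, ·)`. OURS (typing). [folklore] -/
def Dv (D : Matrix b s ℝ) (T' : Matrix s b ℝ) : Matrix (Δ × b) b ℝ :=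
  Matrix.of fun p c => (D * dpart dir p.1 T') p.2 c

/-- the coefficient `Dm₁ : Matrix b (Δ × b) ℝ`, `Dm₁(a, (μ, a′)) = [a′ = a]·θ_μ(sb a)` (first differences).
OURS (typing). [folklore] -/
def Dm₁ (sb : b → E) (θs : Δ → E → ℝ) : Matrix b (Δ × b) ℝ :=
  Matrix.of fun a p => if p.2 = a then θs p.1 (sb a) else 0

variable [Fintype Δ]

/-- **`∂·(T′·Θ_h) = Σ_μ diagonal (θ_μ ∘ sb)·(∂·T′_μ) + Σ_μ Θ_(θ_μ)·(T·T′_μ)`** — the product rule: coefficient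
= first differences pulled back to the bond sources, derivative part `∂·T′_μ` (`h`-free mixed second differences),
remainder = SECOND differences `Θ_(θ_μ)` times the `h`-free `T·T′_μ`. [folklore] -/
theorem fwd_mul_bwd_ThE (hT : IsCarried tb xs T) (hJ : IsCarried sb xs J)
    (hθ : ∀ v c, T' v c ≠ 0 → θs (dir c) (xs v) = h (tb c) - h (sb c)) :
    (T - J) * (T' * ThE sb tb h) =
      ∑ μ, Matrix.diagonal (θs μ ∘ sb) * ((T - J) * dpart dir μ T') +
        ∑ μ, ThE sb tb (θs μ) * (T * dpart dir μ T') := by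
  conv_lhs => rw [← sum_dpart dir T']
  rw [Matrix.sum_mul, Matrix.mul_sum, ← Finset.sum_add_distrib]
  refine Finset.sum_congr rfl fun μ _ => ?_
  rw [dpart_mul_ThE dir hθ μ, ← Matrix.mul_assoc, Matrix.sub_mul, ← hT.exchange, ← hJ.exchange, ThE_eq]
  simp only [Matrix.sub_mul, Matrix.mul_sub, Matrix.mul_assoc]
  abel

/-- the remainder `Dm₀ = Σ_μ Θ_(θ_μ)·(T·T′_μ)` (second differences times `h`-free). OURS (typing). [folklore] -/
def Dm₀ (sb tb : b → E) (θs : Δ → E → ℝ) (T : Matrix b s ℝ) (T' : Matrix s b ℝ) : Matrix b b ℝ :=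
  ∑ μ, ThE sb tb (θs μ) * (T * dpart dir μ T')

omit [DecidableEq s] in
/-- `Dm₁·Dv = Σ_μ diagonal (θ_μ ∘ sb)·(∂·T′_μ)`. [folklore] -/
theorem Dm₁_mul_Dv (sb : b → E) (θs : Δ → E → ℝ) (D : Matrix b s ℝ) (T' : Matrix s b ℝ) :
    Dm₁ sb θs * Dv dir D T' = ∑ μ, Matrix.diagonal (θs μ ∘ sb) * (D * dpart dir μ T') := by
  ext a c
  rw [Matrix.mul_apply, Matrix.sum_apply, Fintype.sum_prod_type]
  refine Finset.sum_congr rfl fun μ _ => ?_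
  simp only [Dm₁, Dv, Matrix.of_apply, Matrix.diagonal_mul, Function.comp_apply, ite_mul, zero_mul]
  rw [Finset.sum_ite_eq', if_pos (Finset.mem_univ _)]

/-- **THE `hM` SHAPE: `∂·𝔇(∂*) = Dm₁·Dv + Dm₀`** — literally the shape of the `CutModel` field `hM`, for every
two-part gradient/divergence pair with the stated supports and every family of pulled-back differences `θ_μ`
satisfying `hθ`; exact, every `h`, every dimension. [folklore] -/
theorem hM_shape (hT : IsCarried tb xs T) (hJ : IsCarried sb xs J) (hT' : IsCarried xs tb T')
    (hJ' : IsCarried xs sb J') (hθ : ∀ v c, T' v c ≠ 0 → θs (dir c) (xs v) = h (tb c) - h (sb c)) :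
    (T - J) * tdef (Matrix.diagonal (h ∘ xs)) (Matrix.diagonal (h ∘ sb)) (T' - J') (T' - J') =
      Dm₁ sb θs * Dv dir (T - J) T' + Dm₀ dir sb tb θs T T' := by
  rw [tdef_bwd hT' hJ', fwd_mul_bwd_ThE dir hT hJ hθ, Dm₁_mul_Dv]
  rfl

end TwoPart

/-! ## §5 Several parts: `𝔇(Σ_k K_k) = −Σ_k Θ_k·K_k` and `𝔇(K′K) = Σ_k Σ_l K′_k·Θ_kl·K_l` -/

section Parts

variable {E u v P : Type*} [Fintype u] [Fintype v] [DecidableEq u] [DecidableEq v] [Fintype P]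
variable {ρ : u → E} {κ : v → E} {τ : P → u → E} {K : P → Matrix u v ℝ} {K' : P → Matrix v u ℝ}

/-- **`𝔇(Σ_k K_k) = −Σ_k diagonal (h ∘ τ_k − h ∘ ρ)·K_k`** for parts `K_k` carried by `(τ_k, κ)` (row cutoff
`h ∘ ρ`, column cutoff `h ∘ κ`). [folklore] -/
theorem tdef_parts (hK : ∀ k, IsCarried (τ k) κ (K k)) (h : E → ℝ) :
    tdef (Matrix.diagonal (h ∘ ρ)) (Matrix.diagonal (h ∘ κ)) (∑ k, K k) (∑ k, K k) =
      -∑ k, Matrix.diagonal (fun i => h (τ k i) - h (ρ i)) * K k := by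
  rw [tdef_def, Matrix.mul_sum, Matrix.sum_mul, ← Finset.sum_sub_distrib, ← Finset.sum_neg_distrib]
  refine Finset.sum_congr rfl fun k _ => ?_
  rw [← (hK k).exchange, ← Matrix.sub_mul, ← Matrix.neg_mul]
  congr 1
  rw [Matrix.diagonal_sub, Matrix.diagonal_neg]
  congr 1
  funext i
  simp only [Function.comp_apply, neg_sub]

/-- **`𝔇(Σ_k K′_k) = Σ_k K′_k·diagonal (h ∘ τ_k − h ∘ ρ)`** for parts `K′_k` carried by `(κ, τ_k)`. [folklore] -/
theorem tdef_parts' (hK' : ∀ k, IsCarried κ (τ k) (K' k)) (h : E → ℝ) :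
    tdef (Matrix.diagonal (h ∘ κ)) (Matrix.diagonal (h ∘ ρ)) (∑ k, K' k) (∑ k, K' k) =
      ∑ k, K' k * Matrix.diagonal (fun i => h (τ k i) - h (ρ i)) := by
  rw [tdef_def, Matrix.mul_sum, Matrix.sum_mul, ← Finset.sum_sub_distrib]
  refine Finset.sum_congr rfl fun k _ => ?_
  rw [(hK' k).exchange, ← Matrix.mul_sub]
  congr 1
  rw [Matrix.diagonal_sub]
  rfl

/-- **`𝔇(K′K) = Σ_k Σ_l K′_k·diagonal (h ∘ τ_k − h ∘ τ_l)·K_l`** for parts `K_l` carried by `(τ_l, κ)` and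
`K′_k` carried by `(κ, τ_k)` (the `k = l` terms are visibly zero).  For two parts this is §3; for the four-bond
plaquette rows of the vector operator the `k ≠ l` cross terms between the two target-type parts are the located
obstruction to `hΛ` (header §5). [folklore] -/
theorem tdef_parts_mul (hK : ∀ k, IsCarried (τ k) κ (K k)) (hK' : ∀ k, IsCarried κ (τ k) (K' k)) (h : E → ℝ) :
    tdef (Matrix.diagonal (h ∘ κ)) (Matrix.diagonal (h ∘ κ)) ((∑ k, K' k) * ∑ k, K k) ((∑ k, K' k) * ∑ k, K k) =
      ∑ k, ∑ l, K' k * Matrix.diagonal (fun i => h (τ k i) - h (τ l i)) * K l := by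
  have e1 : Matrix.diagonal (h ∘ κ) * ∑ k, K' k = ∑ k, K' k * Matrix.diagonal (h ∘ τ k) := by
    rw [Matrix.mul_sum]
    exact Finset.sum_congr rfl fun k _ => (hK' k).exchange h
  have e2 : (∑ l, K l) * Matrix.diagonal (h ∘ κ) = ∑ l, Matrix.diagonal (h ∘ τ l) * K l := by
    rw [Matrix.sum_mul]
    exact Finset.sum_congr rfl fun l _ => ((hK l).exchange h).symm
  rw [tdef_def, ← Matrix.mul_assoc, e1, Matrix.mul_assoc, e2, Matrix.sum_mul, Matrix.sum_mul,
    ← Finset.sum_sub_distrib]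
  refine Finset.sum_congr rfl fun k _ => ?_
  rw [Matrix.mul_sum, Matrix.mul_sum, ← Finset.sum_sub_distrib]
  refine Finset.sum_congr rfl fun l _ => ?_
  rw [Matrix.mul_assoc, ← Matrix.mul_sub, ← Matrix.sub_mul, Matrix.diagonal_sub, Matrix.mul_assoc]
  rfl

end Parts

/-! ## §6 Sanity instance: the toy line of `…Toy4` -/

section Toy

variable {n B : ℕ}

/-- the successor-or-self of a site of the toy line (target position of the bond based at the site; the last site
carries the zero bond). OURS (typing). [folklore] -/
def nxt (a : Fin n × Fin B) : Fin n × Fin B := if hk : ι a + 1 < n * B then site (ι a + 1) hk else a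

/-- [folklore] -/
theorem nxt_eq_of_succ {a y : Fin n × Fin B} (hy : ι y = ι a + 1) : nxt a = y := by
  have hk : ι a + 1 < n * B := hy ▸ ι_lt y
  unfold nxt; rw [dif_pos hk]; apply ι_injective; rw [ι_site, hy]

/-- [folklore] -/
theorem nxt_eq_self {a : Fin n × Fin B} (ha : ∀ y : Fin n × Fin B, ι y ≠ ι a + 1) : nxt a = a := by
  unfold nxt; rw [dif_neg]; exact fun hk => ha (site (ι a + 1) hk) (ι_site _ _)

/-- the predecessor-or-self of a site. OURS (typing). [folklore] -/
def prv (e : Fin n × Fin B) : Fin n × Fin B :=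
  if hk : 0 < ι e then site (ι e - 1) (lt_of_lt_of_le (Nat.sub_lt hk Nat.one_pos) (ι_lt e).le) else e

/-- [folklore] -/
theorem prv_eq_of_succ {a y : Fin n × Fin B} (hy : ι y = ι a + 1) : prv y = a := by
  have hk : 0 < ι y := by omega
  unfold prv; rw [dif_pos hk]; apply ι_injective; rw [ι_site, hy]; rfl

/-- [folklore] -/
theorem prv_eq_self {y : Fin n × Fin B} (hy : ∀ x : Fin n × Fin B, ι y ≠ ι x + 1) : prv y = y := by
  unfold prv; rw [dif_neg]
  intro hk
  obtain ⟨x, hx⟩ := exists_pred hk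
  exact hy x hx

/-- **`Θ_h` of the toy instance IS Toy4's `Th h`** (`fd h = h ∘ nxt − h`, including the zero at the last site).
[folklore] -/
theorem ThE_toy (h : Fin n × Fin B → ℝ) : ThE id nxt h = Th h := by
  unfold ThE Th; congr 1; funext a
  by_cases hk : ι a + 1 < n * B
  · obtain ⟨y, hy⟩ := exists_succ hk
    rw [nxt_eq_of_succ hy, fd_eq hy]; rfl
  · have ha : ∀ y : Fin n × Fin B, ι y ≠ ι a + 1 := fun y hy => hk (hy ▸ ι_lt y)
    rw [nxt_eq_self ha, fd_eq_zero ha]; exact sub_self _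

/-- Toy4's backward-shifted differences are `bfd h = h − h ∘ prv` (zero at the first site) — the pulled-back
differences `θ` of §4 on the toy line. [folklore] -/
theorem bfd_eq_sub_prv (h : Fin n × Fin B → ℝ) (e : Fin n × Fin B) : bfd h e = h e - h (prv e) := by
  by_cases hk : 0 < ι e
  · obtain ⟨x, hx⟩ := exists_pred hk
    rw [bfd_eq hx, fd_eq hx, prv_eq_of_succ hx]
  · have he : ∀ x : Fin n × Fin B, ι e ≠ ι x + 1 := fun x hx => hk (by omega)
    rw [bfd_eq_zero he, prv_eq_self he, sub_self]

/-- the weighted shift `diagonal w·S` is carried by `(nxt, id)`. [folklore] -/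
theorem isCarried_wSh (w : Fin n × Fin B → ℝ) : IsCarried nxt id (Matrix.diagonal w * Sh n B) := by
  refine (IsCarried.diagonal_mul ?_ w)
  intro a v hav
  rw [Sh_apply] at hav
  by_cases hy : ι v = ι a + 1
  · exact nxt_eq_of_succ hy
  · exact absurd (if_neg hy) hav

/-- the weighted back-shift `Sᵀ·diagonal w′` is carried by `(id, nxt)`. [folklore] -/
theorem isCarried_wShT (w' : Fin n × Fin B → ℝ) : IsCarried id nxt ((Sh n B).transpose * Matrix.diagonal w') := by
  refine (IsCarried.mul_diagonal ?_ w')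
  intro v a hva
  rw [Matrix.transpose_apply, Sh_apply] at hva
  by_cases hy : ι v = ι a + 1
  · exact (nxt_eq_of_succ hy).symm
  · exact absurd (if_neg hy) hva

variable (h w u w' u' : Fin n × Fin B → ℝ)

/-- **WEIGHTED `dD_eq`: `𝔇(diagonal w·S − diagonal u) = −Θ_h·(diagonal w·S)`** (Toy4's `dD_eq` is `w = u = 1`;
not restated). [folklore] -/
theorem toy_tdef_fwd :
    tdef (Matrix.diagonal h) (Matrix.diagonal h) (Matrix.diagonal w * Sh n B - Matrix.diagonal u)
        (Matrix.diagonal w * Sh n B - Matrix.diagonal u) = -(Th h * (Matrix.diagonal w * Sh n B)) := by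
  have key := tdef_fwd (isCarried_wSh w) (isCarried_diagonal id u) h
  rw [ThE_toy] at key
  exact key

/-- **WEIGHTED `dDt_eq`: `𝔇(Sᵀ·diagonal w′ − diagonal u′) = (Sᵀ·diagonal w′)·Θ_h`**. [folklore] -/
theorem toy_tdef_bwd :
    tdef (Matrix.diagonal h) (Matrix.diagonal h) ((Sh n B).transpose * Matrix.diagonal w' - Matrix.diagonal u')
        ((Sh n B).transpose * Matrix.diagonal w' - Matrix.diagonal u') =
      (Sh n B).transpose * Matrix.diagonal w' * Th h := by
  have key := tdef_bwd (isCarried_wShT w') (isCarried_diagonal id u') h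
  rw [ThE_toy] at key
  exact key

/-- **WEIGHTED `dDtD_eq` (the `hA` shape on the toy line)**: with `∂_w,u = diagonal w·S − diagonal u`,
`∂*_w′,u′ = Sᵀ·diagonal w′ − diagonal u′`:
`𝔇(∂*∂) = (diagonal u′·Θ_h + Sᵀdiagonal w′·Θ_h)·∂ + (diagonal u′·Θ_h·diagonal u − Sᵀdiagonal w′·Θ_h·diagonal w·S)`
(for unit weights the remainder is Toy4's `Ξ_h = Θ_h − SᵀΘ_hS`, `Xi_eq`). [folklore] -/
theorem toy_tdef_bwd_fwd :
    tdef (Matrix.diagonal h) (Matrix.diagonal h)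
        (((Sh n B).transpose * Matrix.diagonal w' - Matrix.diagonal u') * (Matrix.diagonal w * Sh n B - Matrix.diagonal u))
        (((Sh n B).transpose * Matrix.diagonal w' - Matrix.diagonal u') * (Matrix.diagonal w * Sh n B - Matrix.diagonal u)) =
      (Matrix.diagonal u' * Th h + (Sh n B).transpose * Matrix.diagonal w' * Th h) *
          (Matrix.diagonal w * Sh n B - Matrix.diagonal u) +
        (Matrix.diagonal u' * Th h * Matrix.diagonal u -
          (Sh n B).transpose * Matrix.diagonal w' * Th h * (Matrix.diagonal w * Sh n B)) := by
  have key := tdef_bwd_fwd (isCarried_wSh w) (isCarried_diagonal id u) (isCarried_wShT w')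
    (isCarried_diagonal id u') h
  rw [ThE_toy] at key
  exact key

/-- **THE `hM` SHAPE ON THE TOY LINE** (one direction, `θ = bfd h`): `∂·𝔇(∂*) = Dm₁·Dv + Dm₀` with
`Dv = ∂·(Sᵀdiagonal w′)`, `Dm₁ = [bfd h]`, `Dm₀ = Θ_(bfd h)·(diagonal w·S)·(Sᵀdiagonal w′)` — a valid split
DIFFERENT from Toy4's `D_mul_dDt` (`Dv = ∂`); both exact. [folklore] -/
theorem toy_hM_shape :
    (Matrix.diagonal w * Sh n B - Matrix.diagonal u) *
        tdef (Matrix.diagonal h) (Matrix.diagonal h) ((Sh n B).transpose * Matrix.diagonal w' - Matrix.diagonal u')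
          ((Sh n B).transpose * Matrix.diagonal w' - Matrix.diagonal u') =
      Dm₁ id (fun _ : Unit => bfd h) *
          Dv (fun _ : Fin n × Fin B => ()) (Matrix.diagonal w * Sh n B - Matrix.diagonal u)
            ((Sh n B).transpose * Matrix.diagonal w') +
        Dm₀ (fun _ : Fin n × Fin B => ()) id nxt (fun _ : Unit => bfd h) (Matrix.diagonal w * Sh n B)
          ((Sh n B).transpose * Matrix.diagonal w') := by
  have hθ : ∀ v c, ((Sh n B).transpose * Matrix.diagonal w') v c ≠ 0 →
      (fun _ : Unit => bfd h) ((fun _ : Fin n × Fin B => ()) c) (id v) = h (nxt c) - h (id c) := by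
    intro v c hvc
    rw [Matrix.mul_diagonal, Matrix.transpose_apply, Sh_apply] at hvc
    by_cases hy : ι v = ι c + 1
    · show bfd h v = h (nxt c) - h c
      rw [bfd_eq hy, fd_eq hy, nxt_eq_of_succ hy]
    · rw [if_neg hy, zero_mul] at hvc; exact absurd rfl hvc
  exact hM_shape (fun _ => ()) (isCarried_wSh w) (isCarried_diagonal id u) (isCarried_wShT w')
    (isCarried_diagonal id u') hθ

end Toy

end

end Literature.MathematicalPhysics.QuantumFieldTheory.Balaban1983to89.B9SectCLatticeCalc
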